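import Summits.AtomisticToContinuum.Crystallization.Theorems.ChartedZeroExcessLayeredLatticeLiouvilleZZZYN

/-!
# ChartedZeroExcess · LayeredLatticeLiouville ZZZYOA (lens-2 g96 NODE 96b-A «LoadRamp») — the Davidenko load-continuation engine (pure analysis)

Docket `stmt-AtomisticToContinuum-26636`, W2 line.  NODE 96 (file ZZZYN) cut the a-priori piece (X2ᴸ′) into (X1ᴸ′) ∧ (LSᴸ) `LabelLoadStepP` (an
`m`-step march, PROVED); the local step (LSᴸ) is the remaining NONLINEAR statement.  This file is the abstract engine beneath it, with no docket
vocabulary: in a complete normed space `V`, a gradient-like field `G : V → V →L[ℝ] ℝ` with derivative field `Hs` that is `C¹` and INVERTIBLE on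
an open set `U`, whose Newton direction `(Hs x)⁻¹ ψ` lies in a closed convex set `C ∋ 0` throughout a compact response region `Kr ⊆ U`, can be
RAMPED: from any `x₀` whose envelope `x₀ + [0,h]•C` sits in `Kr` with a sup-ball margin, every load increment `σ ∈ [0,h]` is reached by some
`x₁` with `x₁ − x₀ ∈ σ • C` and `G x₁ = G x₀ + σ • ψ` (`exists_loadRamp`).

Mechanism: the Davidenko ODE `x′ = (Hs x)⁻¹ ψ` solved by Picard–Lindelöf (Mathlib `IsPicardLindelof`) on sup-balls of ONE radius (speed and
Lipschitz bounds by compactness of `Kr` and `C¹` of the Newton field — `contDiffAt_map_inverse`), the load identity `G (x σ) = G x₀ + σ ψ` by a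
vanishing derivative (`constant_of_has_deriv_right_zero`), the increment by the closed-convex mean value (`Convex.set_average_mem` on the FTC
integral), and a REACHABILITY induction over `⌈h/τ₀⌉` steps (no gluing of solution curves).  NO generic Green / resolvent norm bound, NO
Hessian–Lipschitz constant and NO step-size condition enter: only the STRUCTURED response bound `(Hs x)⁻¹ψ ∈ C` and qualitative `C¹` regularity —
which is what the desk line E2 found to be the true shape of the problem («KANTOROVICH-SUP-96»: one-shot Newton–Kantorovich in the bond-sup
gauge does not close at the label patch, the march does).  Instantiated to the label tube in file ZZZYO.

* `picardLindelof_hasDerivWithinAt_mem_closedBall` — Mathlib's Picard–Lindelöf with the ball confinement of the solution exported;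
* `sub_mem_smul_of_hasDerivWithinAt` — closed-convex mean value for curves: derivative in `C` on `[a,b]` ⟹ increment in `(b − a) • C`;
* `exists_loadRamp` — ★ the load ramp.

Same namespace as the docket; 3 theorems, 0 def, 0 sorry; imports ZZZYN only (linear chain). [g96]
-/

noncomputable section

open scoped BigOperators Classical NNReal Pointwise
open MeasureTheory Set Metric Filter Topology Function

namespace Summit.AtomisticToContinuum.Crystallization.Theorems.ChartedZeroExcessLayeredLatticeLiouville

/-! ### ZZZYOA-1  The load ramp (Davidenko continuation in a gauge), PROVED -/

section LoadRamp

variable {V : Type*} [NormedAddCommGroup V] [NormedSpace ℝ V] [CompleteSpace V]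

/-- Picard–Lindelöf (Mathlib's `IsPicardLindelof`) with the BALL CONFINEMENT of the solution exported: the integral curve stays in
`closedBall x₀ a` for all times, on the PRESCRIBED time interval of the structure (the reachability induction of `exists_loadRamp` needs a
uniform step; the tree's `Literature.Analysis.FluidPDE.exists_forall_hasDerivWithinAt_Icc_mem_closedBall` is the autonomous `∃ T`-form at
time origin `0`, which hides the step length). [this file, g96] -/
theorem picardLindelof_hasDerivWithinAt_mem_closedBall
    {f : ℝ → V → V} {tmin tmax : ℝ} {t₀ : Icc tmin tmax} {x₀ x : V} {a r L K : ℝ≥0}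
    (hf : IsPicardLindelof f t₀ x₀ a r L K) (hx : x ∈ closedBall x₀ r) :
    ∃ α : ℝ → V, α t₀ = x ∧ (∀ t, α t ∈ closedBall x₀ a) ∧
      ∀ t ∈ Icc tmin tmax, HasDerivWithinAt α (f t (α t)) (Icc tmin tmax) t := by
  obtain ⟨α, hα⟩ := ODE.FunSpace.exists_isFixedPt_next hf hx
  refine ⟨α.compProj, by rw [ODE.FunSpace.compProj_val, ← hα, ODE.FunSpace.next_apply₀],
    fun t => α.compProj_mem_closedBall hf.mul_max_le, fun t ht ↦ ?_⟩
  apply ODE.hasDerivWithinAt_picard_Icc t₀.2 hf.continuousOn_uncurry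
    α.continuous_compProj.continuousOn (fun _ ht' ↦ α.compProj_mem_closedBall hf.mul_max_le)
    x ht |>.congr_of_mem _ ht
  intro t' ht'
  nth_rw 1 [← hα]
  rw [ODE.FunSpace.compProj_of_mem ht', ODE.FunSpace.next_apply]

/-- ★ closed-convex mean value for curves: a curve on `[a, b]` whose (one-sided) derivative `w t` is continuous and lies in a closed convex
nonempty set `C` has increment `α b − α a ∈ (b − a) • C`. [this file, g96] -/
theorem sub_mem_smul_of_hasDerivWithinAt {α w : ℝ → V} {C : Set V} {a b : ℝ} (hab : a ≤ b)
    (hC : Convex ℝ C) (hCcl : IsClosed C) (hCne : C.Nonempty)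
    (hα : ∀ t ∈ Icc a b, HasDerivWithinAt α (w t) (Icc a b) t)
    (hw : ContinuousOn w (Icc a b)) (hmem : ∀ t ∈ Icc a b, w t ∈ C) :
    α b - α a ∈ (b - a) • C := by
  rcases hab.eq_or_lt with rfl | hlt
  · rw [sub_self, sub_self, zero_smul_set hCne]; exact Set.mem_zero.mpr rfl
  have hcont : ContinuousOn α (Icc a b) := fun t ht => (hα t ht).continuousWithinAt
  have hder : ∀ t ∈ Ioo a b, HasDerivWithinAt α (w t) (Ioi t) t := fun t ht =>
    (hα t (Ioo_subset_Icc_self ht)).mono_of_mem_nhdsWithin (mem_nhdsWithin_of_mem_nhds (Icc_mem_nhds ht.1 ht.2))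
  have hint : IntervalIntegrable w volume a b := (hw.mono (by rw [uIcc_of_le hab])).intervalIntegrable
  have hftc : ∫ t in a..b, w t = α b - α a := intervalIntegral.integral_eq_sub_of_hasDeriv_right_of_le hab hcont hder hint
  have hvol : volume (Ioc a b) = ENNReal.ofReal (b - a) := Real.volume_Ioc
  have hba : 0 < b - a := sub_pos.mpr hlt
  have hne : volume (Ioc a b) ≠ 0 := by rw [hvol]; exact (ENNReal.ofReal_pos.mpr hba).ne'
  have havg : ⨍ t in Ioc a b, w t ∈ C :=
    hC.set_average_mem hCcl hne (by rw [hvol]; exact ENNReal.ofReal_ne_top)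
      (ae_restrict_of_forall_mem measurableSet_Ioc fun t ht => hmem t (Ioc_subset_Icc_self ht))
      ((hw.integrableOn_Icc).mono_set Ioc_subset_Icc_self)
  have hreal : volume.real (Ioc a b) = b - a := by rw [Measure.real, hvol, ENNReal.toReal_ofReal hba.le]
  have heq : α b - α a = (b - a) • ⨍ t in Ioc a b, w t := by
    rw [← hftc, intervalIntegral.integral_of_le hab, setAverage_eq, hreal, smul_inv_smul₀ hba.ne']
  rw [heq]
  exact smul_mem_smul_set havg

/-- ★★★ **THE LOAD RAMP (Davidenko continuation in a gauge).**  `G : V → V →L[ℝ] ℝ` differentiable on the open `U` with derivative field `Hs`,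
`Hs` of class `C¹` and invertible on `U`; `Kr ⊆ U` compact; `C` closed convex with `0 ∈ C`; the Newton direction for the load `ψ` lies in `C`
throughout `Kr` (`∃ v ∈ C, Hs x v = ψ`); the envelope of `x₀` for loads `σ ∈ [0,h]` sits in `Kr` with a ball margin `δ₀ > 0`.  THEN every load is
reached inside the gauge: `∀ σ ∈ [0,h], ∃ x₁, x₁ − x₀ ∈ σ • C ∧ G x₁ = G x₀ + σ • ψ`.  No norm bound on `(Hs x)⁻¹`, no Lipschitz constant of `Hs` and
no step-size condition are assumed. [this file, g96] -/
theorem exists_loadRamp {U Kr C : Set V} {G : V → (V →L[ℝ] ℝ)} {Hs : V → (V →L[ℝ] (V →L[ℝ] ℝ))} {ψ : V →L[ℝ] ℝ} {x₀ : V} {h δ₀ : ℝ}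
    (hU : IsOpen U) (hKU : Kr ⊆ U) (hKc : IsCompact Kr)
    (hG : ∀ x ∈ U, HasFDerivAt G (Hs x) x) (hHs : ContDiffOn ℝ 1 Hs U)
    (hinv : ∀ x ∈ U, ∃ e : V ≃L[ℝ] (V →L[ℝ] ℝ), (e : V →L[ℝ] (V →L[ℝ] ℝ)) = Hs x)
    (hCc : Convex ℝ C) (hCcl : IsClosed C) (hC0 : (0 : V) ∈ C)
    (hresp : ∀ x ∈ Kr, ∃ v ∈ C, Hs x v = ψ)
    (hh : 0 ≤ h) (hδ₀ : 0 < δ₀)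
    (henv : ∀ σ ∈ Icc 0 h, ∀ c ∈ C, closedBall (x₀ + σ • c) δ₀ ⊆ Kr) :
    ∀ σ ∈ Icc 0 h, ∃ x₁ : V, x₁ - x₀ ∈ σ • C ∧ G x₁ = G x₀ + σ • ψ := by
  -- the Newton direction field
  set v : V → V := fun x => (Hs x).inverse ψ with hv_def
  have hHv : ∀ x ∈ U, Hs x (v x) = ψ := by
    intro x hx
    obtain ⟨e, he⟩ := hinv x hx
    simp only [hv_def, ← he, ContinuousLinearMap.inverse_equiv, ContinuousLinearEquiv.coe_coe,
      ContinuousLinearEquiv.apply_symm_apply]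
  have hvmem : ∀ x ∈ Kr, v x ∈ C := by
    intro x hx
    obtain ⟨w, hwC, hw⟩ := hresp x hx
    obtain ⟨e, he⟩ := hinv x (hKU hx)
    have h1 : e w = e (v x) := by
      have h2 : Hs x w = Hs x (v x) := by rw [hw, hHv x (hKU hx)]
      simpa only [← he, ContinuousLinearEquiv.coe_coe] using h2
    rwa [← e.injective h1]
  have hvC1 : ContDiffOn ℝ 1 v U := by
    intro x hx
    obtain ⟨e, he⟩ := hinv x hx
    have h1 : ContDiffAt ℝ 1 (ContinuousLinearMap.inverse : (V →L[ℝ] (V →L[ℝ] ℝ)) → ((V →L[ℝ] ℝ) →L[ℝ] V)) (Hs x) :=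
      he ▸ contDiffAt_map_inverse e
    have h2 : ContDiffWithinAt ℝ 1 (fun y => (Hs y).inverse) U x := h1.comp_contDiffWithinAt x (hHs x hx)
    exact h2.clm_apply contDiffWithinAt_const
  have hvcont : ContinuousOn v U := hvC1.continuousOn
  have hvdiff : ∀ x ∈ U, DifferentiableAt ℝ v x := fun x hx =>
    (hvC1.differentiableOn one_ne_zero x hx).differentiableAt (hU.mem_nhds hx)
  have hfdcont : ContinuousOn (fun x => fderiv ℝ v x) U := hvC1.continuousOn_fderiv_of_isOpen hU le_rfl
  -- uniform bounds on the compact response region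
  obtain ⟨M, hM⟩ := hKc.exists_bound_of_continuousOn (hvcont.mono hKU)
  obtain ⟨K₀, hK₀⟩ := hKc.exists_bound_of_continuousOn (hfdcont.mono hKU)
  have hM1 : 0 < max M 0 + 1 := by positivity
  set L : ℝ≥0 := ⟨max M 0 + 1, hM1.le⟩ with hL_def
  set K : ℝ≥0 := ⟨max K₀ 0, le_max_right _ _⟩ with hK_def
  set a : ℝ≥0 := ⟨δ₀, hδ₀.le⟩ with ha_def
  set τ₀ : ℝ := δ₀ / (max M 0 + 1) with hτ₀_def
  have hτ₀ : 0 < τ₀ := div_pos hδ₀ hM1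
  -- ONE STEP of the ramp: from a point whose δ₀-ball lies in `Kr`, every load increment `≤ τ₀` is reached inside the gauge
  have step : ∀ x : V, closedBall x δ₀ ⊆ Kr → ∀ σ₀ σ : ℝ, σ₀ ≤ σ → σ ≤ σ₀ + τ₀ →
      ∃ y : V, y - x ∈ (σ - σ₀) • C ∧ G y = G x + (σ - σ₀) • ψ := by
    intro x hball σ₀ σ h0σ hστ
    have hb : ∀ y ∈ closedBall x (a : ℝ), ‖v y‖ ≤ L := fun y hy =>
      (hM y (hball hy)).trans ((le_max_left M 0).trans (le_add_of_nonneg_right zero_le_one))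
    have hl : LipschitzOnWith K v (closedBall x (a : ℝ)) := by
      refine Convex.lipschitzOnWith_of_nnnorm_fderiv_le (𝕜 := ℝ) (fun y hy => hvdiff y (hKU (hball hy))) (fun y hy => ?_)
        (convex_closedBall x _)
      rw [← NNReal.coe_le_coe, coe_nnnorm]
      exact (hK₀ y (hball hy)).trans (le_max_left K₀ 0)
    have ht₀ : σ₀ ∈ Icc σ₀ (σ₀ + τ₀) := ⟨le_rfl, by linarith⟩
    have hm : (L : ℝ) * max (σ₀ + τ₀ - (⟨σ₀, ht₀⟩ : Icc σ₀ (σ₀ + τ₀))) ((⟨σ₀, ht₀⟩ : Icc σ₀ (σ₀ + τ₀)) - σ₀) ≤ a - (0 : ℝ≥0) := by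
      show (max M 0 + 1) * max (σ₀ + τ₀ - σ₀) (σ₀ - σ₀) ≤ δ₀ - 0
      rw [add_sub_cancel_left, sub_self, max_eq_left hτ₀.le, sub_zero, hτ₀_def, mul_div_cancel₀ _ hM1.ne']
    have hpl : IsPicardLindelof (fun (_ : ℝ) => v) (⟨σ₀, ht₀⟩ : Icc σ₀ (σ₀ + τ₀)) x a 0 L K :=
      IsPicardLindelof.of_time_independent hb hl hm
    obtain ⟨α, hα0, hαball, hαder⟩ :=
      picardLindelof_hasDerivWithinAt_mem_closedBall hpl (mem_closedBall_self (NNReal.coe_nonneg _))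
    simp only at hα0 hαder
    have hαKr : ∀ t, α t ∈ Kr := fun t => hball (hαball t)
    have hσmem : σ ∈ Icc σ₀ (σ₀ + τ₀) := ⟨h0σ, hστ⟩
    -- the load identity `G (α t) = G x + (t − σ₀) • ψ` (vanishing derivative)
    have hΦder : ∀ t ∈ Icc σ₀ (σ₀ + τ₀), HasDerivWithinAt (fun t => G (α t) - (t - σ₀) • ψ) 0 (Icc σ₀ (σ₀ + τ₀)) t := by
      intro t ht
      have h1 : HasDerivWithinAt (G ∘ α) ((Hs (α t)) (v (α t))) (Icc σ₀ (σ₀ + τ₀)) t :=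
        (hG _ (hKU (hαKr t))).comp_hasDerivWithinAt t (hαder t ht)
      rw [hHv _ (hKU (hαKr t))] at h1
      have h2 : HasDerivWithinAt (fun t : ℝ => (t - σ₀) • ψ) ((1 : ℝ) • ψ) (Icc σ₀ (σ₀ + τ₀)) t :=
        ((hasDerivWithinAt_id t _).sub_const σ₀).smul_const ψ
      have h3 := h1.sub h2
      rwa [one_smul, sub_self] at h3
    have hΦcont : ContinuousOn (fun t => G (α t) - (t - σ₀) • ψ) (Icc σ₀ (σ₀ + τ₀)) := fun t ht => (hΦder t ht).continuousWithinAt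
    have hΦconst := constant_of_has_deriv_right_zero hΦcont (fun t ht =>
      (hΦder t (Ico_subset_Icc_self ht)).mono_of_mem_nhdsWithin
        (Filter.mem_of_superset (Icc_mem_nhdsGE ht.2) (Icc_subset_Icc ht.1 le_rfl))) σ hσmem
    simp only [sub_self, zero_smul, sub_zero, hα0] at hΦconst
    -- the increment `α σ − x ∈ (σ − σ₀) • C` (closed-convex mean value)
    have hαcont : ContinuousOn α (Icc σ₀ σ) := fun t ht =>
      ((hαder t ⟨ht.1, ht.2.trans hστ⟩).continuousWithinAt).mono (Icc_subset_Icc le_rfl hστ)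
    have hinc : α σ - α σ₀ ∈ (σ - σ₀) • C :=
      sub_mem_smul_of_hasDerivWithinAt h0σ hCc hCcl ⟨0, hC0⟩
        (fun t ht => (hαder t ⟨ht.1, ht.2.trans hστ⟩).mono (Icc_subset_Icc le_rfl hστ))
        (hvcont.comp hαcont fun t _ => hKU (hαKr t)) (fun t _ => hvmem _ (hαKr t))
    refine ⟨α σ, ?_, ?_⟩
    · rwa [hα0] at hinc
    · rw [← hΦconst, sub_add_cancel]
  -- REACHABILITY by induction on the number of steps
  have henv' : ∀ x : V, ∀ σ₀ ∈ Icc 0 h, x - x₀ ∈ σ₀ • C → closedBall x δ₀ ⊆ Kr := by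
    intro x σ₀ hσ₀ hx
    obtain ⟨c, hc, hxc⟩ := Set.mem_smul_set.mp hx
    have e : x = x₀ + σ₀ • c := by rw [hxc]; abel
    rw [e]; exact henv σ₀ hσ₀ c hc
  have hadd : ∀ {p q : ℝ} {y z : V}, 0 ≤ p → 0 ≤ q → y ∈ p • C → z ∈ q • C → y + z ∈ (p + q) • C := by
    intro p q y z hp hq hy hz
    rw [hCc.add_smul hp hq]; exact Set.add_mem_add hy hz
  have reach : ∀ j : ℕ, ∀ x : V, ∀ σ₀ : ℝ, σ₀ ∈ Icc 0 h → x - x₀ ∈ σ₀ • C → G x = G x₀ + σ₀ • ψ →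
      ∀ σ₁ ∈ Icc σ₀ (min h (σ₀ + j * τ₀)), ∃ x₁ : V, x₁ - x₀ ∈ σ₁ • C ∧ G x₁ = G x₀ + σ₁ • ψ := by
    intro j
    induction j with
    | zero =>
      intro x σ₀ hσ₀ hx hGx σ₁ hσ₁
      have e : σ₁ = σ₀ := le_antisymm (by simpa using hσ₁.2.trans (min_le_right _ _)) hσ₁.1
      exact ⟨x, e ▸ hx, e ▸ hGx⟩
    | succ j ih =>
      intro x σ₀ hσ₀ hx hGx σ₁ hσ₁
      have hσ₁h : σ₁ ≤ h := hσ₁.2.trans (min_le_left _ _)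
      by_cases hc : σ₁ ≤ σ₀ + τ₀
      · obtain ⟨y, hy, hGy⟩ := step x (henv' x σ₀ hσ₀ hx) σ₀ σ₁ hσ₁.1 hc
        refine ⟨y, ?_, ?_⟩
        · have := hadd hσ₀.1 (sub_nonneg.mpr hσ₁.1) hx hy
          rwa [add_sub_cancel, sub_add_sub_cancel'] at this
        · rw [show G y = G x + (σ₁ - σ₀) • ψ from hGy, hGx, add_assoc, ← add_smul, add_sub_cancel]
      · rw [not_le] at hc
        obtain ⟨y, hy, hGy⟩ := step x (henv' x σ₀ hσ₀ hx) σ₀ (σ₀ + τ₀) (by linarith) le_rfl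
        have hσ' : σ₀ + τ₀ ∈ Icc 0 h := ⟨by linarith [hσ₀.1], by linarith⟩
        have hy' : y - x₀ ∈ (σ₀ + τ₀) • C := by
          have := hadd hσ₀.1 hτ₀.le hx (by rwa [add_sub_cancel_left] at hy)
          rwa [sub_add_sub_cancel'] at this
        have hGy' : G y = G x₀ + (σ₀ + τ₀) • ψ := by
          rw [hGy, hGx, add_assoc, ← add_smul, add_sub_cancel]
        refine ih y (σ₀ + τ₀) hσ' hy' hGy' σ₁ ⟨hc.le, ?_⟩
        rw [Nat.cast_succ] at hσ₁
        refine le_min hσ₁h ?_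
        have := hσ₁.2.trans (min_le_right _ _)
        linarith
  -- assemble: `⌈h / τ₀⌉₊` steps reach every `σ ∈ [0, h]`
  intro σ hσ
  have hx₀ : x₀ - x₀ ∈ (0 : ℝ) • C := by rw [sub_self, zero_smul_set ⟨0, hC0⟩]; exact Set.mem_zero.mpr rfl
  refine reach ⌈h / τ₀⌉₊ x₀ 0 ⟨le_rfl, hh⟩ hx₀ (by rw [zero_smul, add_zero]) σ ⟨hσ.1, le_min hσ.2 ?_⟩
  rw [zero_add]
  have h1 : h / τ₀ ≤ ⌈h / τ₀⌉₊ := Nat.le_ceil _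
  rw [div_le_iff₀ hτ₀] at h1
  exact hσ.2.trans h1

end LoadRamp

end Summit.AtomisticToContinuum.Crystallization.Theorems.ChartedZeroExcessLayeredLatticeLiouville
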